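import Mathlib
import HarnessLib
import Summits.QuantumFields.YangMills.Theorems.LangevinControlUVFemtoCurvatureSkewnessTreeRatioFloorMomentum

/-!
# `FemtoCurvatureSkewness` — the mass weights of the lazy-walk expansion (stub `TreeRatioFloor`, crux stmt-QuantumFields-9365)

The lazy-walk expansion `1/(μ + k̂²(p₁) + k̂²(p₂)) = Σ_m 4^m (q(p₁)+q(p₂))^m/(μ+8)^{m+1}` of the sliced transverse torus
propagator produces the mass weights `D(m) = Σ_q μ(q) 8^m/(μ(q)+8)^{m+1}` (`massD`).  We prove `0 ≤ D(m) ≤ L²` and the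
two-sided size estimate `e^{-π²/4} L²/(2048 m²) ≤ D(m) ≤ 1700 L²/m²` in the ranges `16m ≤ L²` (lower bound: a box of
`(k₀,k₁)` of side `≍ L/√m`) and `1 ≤ m ≤ L²` (upper bound: `D ≤ ¼ Θ₁ Θ₀` with the theta sums `Θ₀ = Σ_a e^{-mk̂²(a)/16} ≲ L/√m`,
`Θ₁ = Σ_a k̂²(a) e^{-mk̂²(a)/16} ≲ L/m^{3/2}`).  Mathlib only.
-/

noncomputable section

namespace Summit.QuantumFields.YangMills.Theorems.FemtoCurvatureSkewness

open Finset
open scoped BigOperators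

namespace TreeRatio

variable (L : ℕ)

/-! ## The mass weights `D(m)` -/

variable [NeZero L]

/-- The mass weights `D(m) = Σ_q μ(q) 8^m/(μ(q)+8)^{m+1}` of the lazy-walk expansion. -/
def massD (m : ℕ) : ℝ := ∑ q : ZMod L × ZMod L, mass L q * 8 ^ m / (mass L q + 8) ^ (m + 1)

/-- `0 ≤ D(m)`. -/
theorem massD_nonneg (m : ℕ) : 0 ≤ massD L m := sum_nonneg fun q _ => massD_term_nonneg L m q

/-- `D(m) ≤ L²`. -/
theorem massD_le_sq (m : ℕ) : massD L m ≤ (L : ℝ) ^ 2 := by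
  calc massD L m ≤ ∑ _q : ZMod L × ZMod L, (1 : ℝ) := sum_le_sum fun q _ => massD_term_le_one L m q
    _ = (L : ℝ) ^ 2 := by simp [sq]

omit [NeZero L] in
/-- Boundary reindexing: `Σ_{v<L} g(L - v) = Σ_{d<L} g(d + 1)`. -/
theorem sum_range_sub_eq (g : ℝ → ℝ) : ∑ v ∈ range L, g ((L : ℝ) - v) = ∑ d ∈ range L, g ((d : ℝ) + 1) := by
  conv_rhs => rw [← sum_range_reflect (fun d => g ((d : ℝ) + 1)) L]
  refine sum_congr rfl fun d hd => ?_
  have hd' : d < L := mem_range.mp hd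
  congr 1
  rw [Nat.cast_sub (by omega), Nat.cast_sub (by omega)]
  push_cast
  ring

/-- Dropping the first term: `Σ_{v<L} g(v) ≤ g(0) + Σ_{d<L} g(d+1)` for `g ≥ 0`. -/
theorem sum_range_le_first_add (g : ℝ → ℝ) (hg : ∀ v, 0 ≤ g v) :
    ∑ v ∈ range L, g v ≤ g 0 + ∑ d ∈ range L, g ((d : ℝ) + 1) := by
  obtain ⟨L', hL'⟩ : ∃ L', L = L' + 1 := ⟨L - 1, by have := NeZero.ne L; omega⟩
  have h1 : ∑ v ∈ range (L' + 1), g v = (∑ v ∈ range L', g ((v + 1 : ℕ) : ℝ)) + g ((0 : ℕ) : ℝ) :=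
    sum_range_succ' (fun v => g v) L'
  rw [hL', h1]
  have h2 : ∑ v ∈ range L', g ((v : ℝ) + 1) ≤ ∑ d ∈ range (L' + 1), g ((d : ℝ) + 1) :=
    sum_le_sum_of_subset_of_nonneg (range_subset_range.mpr (Nat.le_succ L')) (fun _ _ _ => hg _)
  push_cast
  linarith

/-- The zeroth theta sum: `Σ_a e^{-m k̂²(a)/16} ≤ 1 + 2 Σ_{d<L} e^{-m(d+1)²/L²}`. -/
theorem theta0_le (m : ℕ) :
    ∑ a : ZMod L, Real.exp (-(m * eps L a) / 16) ≤
      1 + 2 * ∑ d ∈ range L, Real.exp (-((m : ℝ) / (L : ℝ) ^ 2) * ((d : ℝ) + 1) ^ 2) := by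
  have hL : 0 < L := Nat.pos_of_ne_zero (NeZero.ne L)
  have hLr : (0 : ℝ) < L := by exact_mod_cast hL
  set g : ℝ → ℝ := fun v => Real.exp (-((m : ℝ) / (L : ℝ) ^ 2) * v ^ 2) with hg
  have hgpos : ∀ v, 0 < g v := fun v => Real.exp_pos _
  -- termwise: `f(a) ≤ g(a) + g(L - a)`
  have hterm : ∀ a : ZMod L, Real.exp (-(m * eps L a) / 16) ≤ g a.val + g ((L : ℝ) - a.val) := by
    intro a
    rcases le_or_gt (2 * a.val) L with ha | ha
    · have h := sq_le_eps L a hL ha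
      have : Real.exp (-(m * eps L a) / 16) ≤ g a.val := by
        refine Real.exp_le_exp.mpr ?_
        have : ((m : ℝ) / (L : ℝ) ^ 2) * (a.val : ℝ) ^ 2 = m * (16 * (a.val : ℝ) ^ 2 / (L : ℝ) ^ 2) / 16 := by
          field_simp
        rw [neg_mul, this, neg_div]
        gcongr
      linarith [hgpos ((L : ℝ) - a.val)]
    · have h := sq_le_eps' L a hL ha.le
      have : Real.exp (-(m * eps L a) / 16) ≤ g ((L : ℝ) - a.val) := by
        refine Real.exp_le_exp.mpr ?_
        have : ((m : ℝ) / (L : ℝ) ^ 2) * ((L : ℝ) - a.val) ^ 2 = m * (16 * ((L : ℝ) - a.val) ^ 2 / (L : ℝ) ^ 2) / 16 := by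
          field_simp
        rw [neg_mul, this, neg_div]
        gcongr
      linarith [hgpos (a.val : ℝ)]
  have hsum1 : ∑ a : ZMod L, g a.val ≤ 1 + ∑ d ∈ range L, g ((d : ℝ) + 1) := by
    have hz : ∀ f : ℕ → ℝ, ∑ a : ZMod L, f a.val = ∑ v ∈ range L, f v := fun f =>
      Finset.sum_nbij' (fun a => a.val) (fun j => (j : ZMod L)) (fun a _ => mem_range.mpr (ZMod.val_lt a))
        (fun _ _ => mem_univ _) (fun a _ => ZMod.natCast_zmod_val a)
        (fun _ hj => ZMod.val_natCast_of_lt (mem_range.mp hj)) (fun _ _ => rfl)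
    rw [hz (fun v => g v)]
    have hg0 : g 0 = 1 := by simp [hg]
    have := sum_range_le_first_add L g (fun v => (hgpos v).le)
    rw [hg0] at this
    exact this
  have hsum2 : ∑ a : ZMod L, g ((L : ℝ) - a.val) = ∑ d ∈ range L, g ((d : ℝ) + 1) := by
    have hz : ∀ f : ℕ → ℝ, ∑ a : ZMod L, f a.val = ∑ v ∈ range L, f v := fun f =>
      Finset.sum_nbij' (fun a => a.val) (fun j => (j : ZMod L)) (fun a _ => mem_range.mpr (ZMod.val_lt a))
        (fun _ _ => mem_univ _) (fun a _ => ZMod.natCast_zmod_val a)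
        (fun _ hj => ZMod.val_natCast_of_lt (mem_range.mp hj)) (fun _ _ => rfl)
    rw [hz (fun v => g ((L : ℝ) - v))]
    exact sum_range_sub_eq L g
  calc ∑ a : ZMod L, Real.exp (-(m * eps L a) / 16) ≤ ∑ a : ZMod L, (g a.val + g ((L : ℝ) - a.val)) :=
        sum_le_sum fun a _ => hterm a
    _ = ∑ a : ZMod L, g a.val + ∑ a : ZMod L, g ((L : ℝ) - a.val) := sum_add_distrib
    _ ≤ 1 + 2 * ∑ d ∈ range L, g ((d : ℝ) + 1) := by rw [hsum2]; linarith

/-- The first theta sum: `Σ_a k̂²(a) e^{-m k̂²(a)/16} ≤ (8π²/m) Σ_{d<L} e^{-m(d+1)²/(2L²)}` for `m ≥ 1`. -/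
theorem theta1_le {m : ℕ} (hm : 1 ≤ m) :
    ∑ a : ZMod L, eps L a * Real.exp (-(m * eps L a) / 16) ≤
      8 * Real.pi ^ 2 / m * ∑ d ∈ range L, Real.exp (-((m : ℝ) / (2 * (L : ℝ) ^ 2)) * ((d : ℝ) + 1) ^ 2) := by
  have hL : 0 < L := Nat.pos_of_ne_zero (NeZero.ne L)
  have hLr : (0 : ℝ) < L := by exact_mod_cast hL
  have hmr : (0 : ℝ) < m := by exact_mod_cast hm
  set k : ℝ → ℝ := fun v => 4 * Real.pi ^ 2 * v ^ 2 / (L : ℝ) ^ 2 * Real.exp (-((m : ℝ) / (L : ℝ) ^ 2) * v ^ 2) with hk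
  have hkpos : ∀ v, 0 ≤ k v := fun v => by positivity
  have hterm : ∀ a : ZMod L, eps L a * Real.exp (-(m * eps L a) / 16) ≤ k a.val + k ((L : ℝ) - a.val) := by
    intro a
    have he0 := eps_nonneg L a
    rcases le_or_gt (2 * a.val) L with ha | ha
    · have hlo := sq_le_eps L a hL ha
      have hup := eps_le_sq L a
      have : eps L a * Real.exp (-(m * eps L a) / 16) ≤ k a.val := by
        refine mul_le_mul hup (Real.exp_le_exp.mpr ?_) (Real.exp_pos _).le (by positivity)
        have : ((m : ℝ) / (L : ℝ) ^ 2) * (a.val : ℝ) ^ 2 = m * (16 * (a.val : ℝ) ^ 2 / (L : ℝ) ^ 2) / 16 := by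
          field_simp
        rw [neg_mul, this, neg_div]
        gcongr
      linarith [hkpos ((L : ℝ) - a.val)]
    · have hlo := sq_le_eps' L a hL ha.le
      have hup := eps_le_sq' L a hL
      have : eps L a * Real.exp (-(m * eps L a) / 16) ≤ k ((L : ℝ) - a.val) := by
        refine mul_le_mul hup (Real.exp_le_exp.mpr ?_) (Real.exp_pos _).le (by positivity)
        have : ((m : ℝ) / (L : ℝ) ^ 2) * ((L : ℝ) - a.val) ^ 2 = m * (16 * ((L : ℝ) - a.val) ^ 2 / (L : ℝ) ^ 2) / 16 := by
          field_simp
        rw [neg_mul, this, neg_div]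
        gcongr
      linarith [hkpos (a.val : ℝ)]
  have hsum1 : ∑ a : ZMod L, k a.val ≤ ∑ d ∈ range L, k ((d : ℝ) + 1) := by
    have hz : ∀ f : ℕ → ℝ, ∑ a : ZMod L, f a.val = ∑ v ∈ range L, f v := fun f =>
      Finset.sum_nbij' (fun a => a.val) (fun j => (j : ZMod L)) (fun a _ => mem_range.mpr (ZMod.val_lt a))
        (fun _ _ => mem_univ _) (fun a _ => ZMod.natCast_zmod_val a)
        (fun _ hj => ZMod.val_natCast_of_lt (mem_range.mp hj)) (fun _ _ => rfl)
    rw [hz (fun v => k v)]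
    have hk0 : k 0 = 0 := by simp [hk]
    have := sum_range_le_first_add L k hkpos
    rw [hk0, zero_add] at this
    exact this
  have hsum2 : ∑ a : ZMod L, k ((L : ℝ) - a.val) = ∑ d ∈ range L, k ((d : ℝ) + 1) := by
    have hz : ∀ f : ℕ → ℝ, ∑ a : ZMod L, f a.val = ∑ v ∈ range L, f v := fun f =>
      Finset.sum_nbij' (fun a => a.val) (fun j => (j : ZMod L)) (fun a _ => mem_range.mpr (ZMod.val_lt a))
        (fun _ _ => mem_univ _) (fun a _ => ZMod.natCast_zmod_val a)
        (fun _ hj => ZMod.val_natCast_of_lt (mem_range.mp hj)) (fun _ _ => rfl)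
    rw [hz (fun v => k ((L : ℝ) - v))]
    exact sum_range_sub_eq L k
  -- `k(v) ≤ (4π²/m) e^{-m v²/(2L²)}`
  have hkle : ∀ v : ℝ, k v ≤ 4 * Real.pi ^ 2 / m * Real.exp (-((m : ℝ) / (2 * (L : ℝ) ^ 2)) * v ^ 2) := by
    intro v
    have hx : 0 ≤ (m : ℝ) / (L : ℝ) ^ 2 * v ^ 2 := by positivity
    -- `x e^{-x} ≤ e^{-x/2}`, i.e. `x ≤ e^{x/2}`, for `x ≥ 0`
    have hxe : ∀ x : ℝ, 0 ≤ x → x * Real.exp (-x) ≤ Real.exp (-x / 2) := by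
      intro x hx
      have h1 : x ≤ Real.exp (x / 2) := by
        have := Real.add_one_le_exp (x / 4)
        calc x ≤ (x / 4 + 1) ^ 2 := by nlinarith [sq_nonneg (x / 4 - 1)]
          _ ≤ Real.exp (x / 4) ^ 2 := pow_le_pow_left₀ (by linarith) this 2
          _ = Real.exp (x / 2) := by rw [← Real.exp_nat_mul]; ring_nf
      have h2 : Real.exp (-x / 2) = Real.exp (x / 2) * Real.exp (-x) := by rw [← Real.exp_add]; ring_nf
      rw [h2]
      exact mul_le_mul_of_nonneg_right h1 (Real.exp_pos _).le
    have h := hxe _ hx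
    calc k v = 4 * Real.pi ^ 2 / m * ((m : ℝ) / (L : ℝ) ^ 2 * v ^ 2 * Real.exp (-((m : ℝ) / (L : ℝ) ^ 2 * v ^ 2))) := by
          simp only [hk]; field_simp
      _ ≤ 4 * Real.pi ^ 2 / m * Real.exp (-((m : ℝ) / (L : ℝ) ^ 2 * v ^ 2) / 2) := by gcongr
      _ = 4 * Real.pi ^ 2 / m * Real.exp (-((m : ℝ) / (2 * (L : ℝ) ^ 2)) * v ^ 2) := by
          congr 1; congr 1; field_simp
  calc ∑ a : ZMod L, eps L a * Real.exp (-(m * eps L a) / 16) ≤ ∑ a : ZMod L, (k a.val + k ((L : ℝ) - a.val)) :=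
        sum_le_sum fun a _ => hterm a
    _ = ∑ a : ZMod L, k a.val + ∑ a : ZMod L, k ((L : ℝ) - a.val) := sum_add_distrib
    _ ≤ 2 * ∑ d ∈ range L, k ((d : ℝ) + 1) := by rw [hsum2]; linarith
    _ ≤ 2 * ∑ d ∈ range L, 4 * Real.pi ^ 2 / m * Real.exp (-((m : ℝ) / (2 * (L : ℝ) ^ 2)) * ((d : ℝ) + 1) ^ 2) := by
        gcongr with d _; exact hkle _
    _ = 8 * Real.pi ^ 2 / m * ∑ d ∈ range L, Real.exp (-((m : ℝ) / (2 * (L : ℝ) ^ 2)) * ((d : ℝ) + 1) ^ 2) := by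
        rw [← mul_sum]; ring

/-- **Upper bound on the mass weights**: `D(m) ≤ 1700 L²/m²` for `1 ≤ m ≤ L²`. -/
theorem massD_le {m : ℕ} (hm : 1 ≤ m) (hmL : m ≤ L ^ 2) : massD L m ≤ 1700 * (L : ℝ) ^ 2 / (m : ℝ) ^ 2 := by
  have hL : 0 < L := Nat.pos_of_ne_zero (NeZero.ne L)
  have hLr : (0 : ℝ) < L := by exact_mod_cast hL
  have hmr : (1 : ℝ) ≤ m := by exact_mod_cast hm
  have hmL' : (m : ℝ) ≤ (L : ℝ) ^ 2 := by exact_mod_cast hmL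
  -- the scale `s = L/√m ≥ 1`
  set s : ℝ := (L : ℝ) / Real.sqrt m with hs
  have hsq : Real.sqrt (m : ℝ) ^ 2 = m := Real.sq_sqrt (by linarith)
  have hsqpos : 0 < Real.sqrt (m : ℝ) := Real.sqrt_pos.mpr (by linarith)
  have hs2 : s ^ 2 = (L : ℝ) ^ 2 / m := by rw [hs, div_pow, hsq]
  have hs1 : 1 ≤ s := by
    rw [hs, le_div_iff₀ hsqpos, one_mul]
    calc Real.sqrt (m : ℝ) ≤ Real.sqrt ((L : ℝ) ^ 2) := Real.sqrt_le_sqrt hmL'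
      _ = L := Real.sqrt_sq hLr.le
  have hspos : 0 < s := by linarith
  -- Step 1: `D ≤ (1/4) Θ₁ Θ₀`
  set E : ZMod L → ℝ := fun a => eps L a * Real.exp (-(m * eps L a) / 16) with hE
  set F : ZMod L → ℝ := fun a => Real.exp (-(m * eps L a) / 16) with hF
  have hEF : ∑ q : ZMod L × ZMod L, E q.1 * F q.2 = (∑ a, E a) * ∑ a, F a := by
    rw [Fintype.sum_prod_type, sum_mul_sum]
  have hFE : ∑ q : ZMod L × ZMod L, E q.2 * F q.1 = (∑ a, E a) * ∑ a, F a := by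
    rw [Fintype.sum_prod_type_right, sum_mul_sum]
  have h1 : massD L m ≤ (1 / 4) * (∑ a : ZMod L, E a) * (∑ a : ZMod L, F a) := by
    unfold massD
    calc ∑ q : ZMod L × ZMod L, mass L q * 8 ^ m / (mass L q + 8) ^ (m + 1)
        ≤ ∑ q : ZMod L × ZMod L, mass L q / 8 * Real.exp (-(m * mass L q) / 16) :=
          sum_le_sum fun q _ => massD_term_le L m q
      _ = ∑ q : ZMod L × ZMod L, (1 / 8) * (E q.1 * F q.2 + E q.2 * F q.1) := by
          refine sum_congr rfl fun q _ => ?_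
          simp only [mass, hE, hF]
          rw [show -(↑m * (eps L q.1 + eps L q.2)) / 16 = -(m * eps L q.1) / 16 + -(m * eps L q.2) / 16 by ring,
            Real.exp_add]
          ring
      _ = (1 / 4) * (∑ a : ZMod L, E a) * (∑ a : ZMod L, F a) := by
          rw [← mul_sum, sum_add_distrib, hEF, hFE]; ring
  -- Step 2: the two theta sums
  have hg1 := sum_exp_neg_mul_sq_le (a := (m : ℝ) / (L : ℝ) ^ 2) (b := s) (by positivity) hs1
    (by rw [hs2]; field_simp) L
  have hg2 := sum_exp_neg_mul_sq_le (a := (m : ℝ) / (2 * (L : ℝ) ^ 2)) (b := Real.sqrt 2 * s) (by positivity)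
    (by nlinarith [Real.one_lt_sqrt_two]) (by rw [mul_pow, Real.sq_sqrt (by norm_num), hs2]; field_simp) L
  have hθ0 : ∑ a : ZMod L, F a ≤ 11 * s := by
    have := theta0_le L m; simp only [hF]; nlinarith
  have hθ1 : ∑ a : ZMod L, E a ≤ 8 * Real.pi ^ 2 / m * (5 * (Real.sqrt 2 * s)) := by
    simp only [hE]
    refine (theta1_le L hm).trans ?_
    gcongr
  have hθ1pos : 0 ≤ ∑ a : ZMod L, E a :=
    sum_nonneg fun a _ => mul_nonneg (eps_nonneg L a) (Real.exp_pos _).le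
  have hθ0pos : 0 ≤ ∑ a : ZMod L, F a := sum_nonneg fun a _ => (Real.exp_pos _).le
  -- Step 3: numerics `(1/4) · 40√2π² · 11 ≤ 1700`
  have hπ : Real.pi ^ 2 ≤ 10 := by nlinarith [Real.pi_lt_d2, Real.pi_pos]
  have h2 : Real.sqrt 2 ≤ 3 / 2 := by
    rw [Real.sqrt_le_left (by norm_num)]; norm_num
  calc massD L m ≤ (1 / 4) * (8 * Real.pi ^ 2 / m * (5 * (Real.sqrt 2 * s))) * (11 * s) := by
        refine h1.trans ?_
        gcongr
    _ = (110 * (Real.pi ^ 2 * Real.sqrt 2)) * (s ^ 2 / m) := by ring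
    _ ≤ (110 * (10 * (3 / 2))) * (s ^ 2 / m) := by gcongr
    _ ≤ 1700 * (s ^ 2 / m) := by gcongr; norm_num
    _ = 1700 * (L : ℝ) ^ 2 / (m : ℝ) ^ 2 := by rw [hs2]; field_simp

/-- **Lower bound on the mass weights**: `D(m) ≥ e^{-π²/4} L²/(2048 m²)` for `1 ≤ m`, `16 m ≤ L²`. -/
theorem le_massD {m : ℕ} (hm : 1 ≤ m) (hmL : 16 * m ≤ L ^ 2) :
    Real.exp (-(Real.pi ^ 2 / 4)) / 2048 * (L : ℝ) ^ 2 / (m : ℝ) ^ 2 ≤ massD L m := by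
  have hL : 0 < L := Nat.pos_of_ne_zero (NeZero.ne L)
  have hLr : (0 : ℝ) < L := by exact_mod_cast hL
  have hmr : (1 : ℝ) ≤ m := by exact_mod_cast hm
  -- the box size `K = ⌊√(L²/(4m))⌋`
  set n0 : ℕ := L ^ 2 / (4 * m) with hn0
  set K : ℕ := Nat.sqrt n0 with hK
  have hn04 : 4 ≤ n0 := by rw [hn0]; exact (Nat.le_div_iff_mul_le (by omega)).mpr (by omega)
  have hK2 : 2 ≤ K := by
    calc 2 = Nat.sqrt (2 ^ 2) := (Nat.sqrt_eq' 2).symm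
      _ ≤ Nat.sqrt n0 := Nat.sqrt_le_sqrt hn04
  have hKup : 4 * m * K ^ 2 ≤ L ^ 2 := by
    have h1 : K ^ 2 ≤ n0 := Nat.sqrt_le' n0
    calc 4 * m * K ^ 2 ≤ 4 * m * n0 := Nat.mul_le_mul_left _ h1
      _ ≤ L ^ 2 := by rw [hn0]; exact Nat.mul_div_le (L ^ 2) (4 * m)
  have hKlo : L ^ 2 < 16 * m * K ^ 2 := by
    have h1 : n0 < (K + 1) ^ 2 := Nat.lt_succ_sqrt' n0
    have h2 : L ^ 2 < 4 * m * (n0 + 1) := by rw [hn0]; exact Nat.lt_mul_div_succ (L ^ 2) (by omega)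
    have h3 : (K + 1) ^ 2 ≤ 4 * K ^ 2 := by nlinarith
    calc L ^ 2 < 4 * m * (n0 + 1) := h2
      _ ≤ 4 * m * (K + 1) ^ 2 := Nat.mul_le_mul_left _ h1
      _ ≤ 4 * m * (4 * K ^ 2) := Nat.mul_le_mul_left _ h3
      _ = 16 * m * K ^ 2 := by ring
  have hKL : 2 * K ≤ L := by nlinarith
  have hKltL : K < L := by omega
  have hKr : (4 : ℝ) * m * (K : ℝ) ^ 2 ≤ (L : ℝ) ^ 2 := by exact_mod_cast hKup
  have hKr' : (L : ℝ) ^ 2 < 16 * m * (K : ℝ) ^ 2 := by exact_mod_cast hKlo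
  -- the half box
  set J : Finset ℕ := Icc (K / 2 + 1) K with hJ
  have hJcard : (K : ℝ) / 2 ≤ (J.card : ℝ) := by
    have h1 : J.card = K - K / 2 := by rw [hJ, Nat.card_Icc]; omega
    rw [h1, Nat.cast_sub (Nat.div_le_self K 2)]
    have h2 : ((K / 2 : ℕ) : ℝ) ≤ (K : ℝ) / 2 := Nat.cast_div_le
    linarith
  have hJmem : ∀ j ∈ J, (K : ℝ) / 2 ≤ j ∧ (j : ℝ) ≤ K ∧ (1 : ℝ) ≤ j := by
    intro j hj
    rw [hJ, mem_Icc] at hj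
    refine ⟨?_, by exact_mod_cast hj.2, by exact_mod_cast (show 1 ≤ j by omega)⟩
    have h2 : (K : ℝ) / 2 < ((K / 2 + 1 : ℕ) : ℝ) := by
      have := Nat.lt_div_mul_add (a := K) (b := 2) (by norm_num)
      have h' : (K : ℝ) < ((K / 2 : ℕ) : ℝ) * 2 + 2 := by exact_mod_cast this
      push_cast; linarith
    have h3 : ((K / 2 + 1 : ℕ) : ℝ) ≤ j := by exact_mod_cast hj.1
    linarith
  -- embed the box into `ZMod L × ZMod L`
  let ι : ℕ × ℕ → ZMod L × ZMod L := fun jk => ((jk.1 : ZMod L), (jk.2 : ZMod L))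
  have hval : ∀ j ∈ J, ((j : ZMod L)).val = j := fun j hj =>
    ZMod.val_natCast_of_lt (lt_of_le_of_lt (mem_Icc.mp (by rw [hJ] at hj; exact hj)).2 hKltL)
  have hinj : Set.InjOn ι (J ×ˢ J : Finset (ℕ × ℕ)) := by
    intro x hx x' hx' h
    simp only [coe_product, Set.mem_prod, mem_coe] at hx hx'
    simp only [ι, Prod.mk.injEq] at h
    have h1 := congrArg ZMod.val h.1
    have h2 := congrArg ZMod.val h.2
    rw [hval _ hx.1, hval _ hx'.1] at h1
    rw [hval _ hx.2, hval _ hx'.2] at h2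
    exact Prod.ext h1 h2
  -- termwise lower bound on the box
  set c0 : ℝ := Real.exp (-(Real.pi ^ 2 / 4)) with hc0
  have hbox : ∀ jk ∈ (J ×ˢ J : Finset (ℕ × ℕ)),
      c0 * (K : ℝ) ^ 2 / (2 * (L : ℝ) ^ 2) ≤ mass L (ι jk) * 8 ^ m / (mass L (ι jk) + 8) ^ (m + 1) := by
    intro jk hjk
    rw [mem_product] at hjk
    obtain ⟨hj1, hj2, hj3⟩ := hJmem _ hjk.1
    obtain ⟨hk1, hk2, hk3⟩ := hJmem _ hjk.2
    have hvj : ((ι jk).1).val = jk.1 := hval _ hjk.1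
    have hvk : ((ι jk).2).val = jk.2 := hval _ hjk.2
    -- mass bounds
    have hup : mass L (ι jk) ≤ 2 * Real.pi ^ 2 / m := by
      have e1 := eps_le_sq L (ι jk).1
      have e2 := eps_le_sq L (ι jk).2
      rw [hvj] at e1; rw [hvk] at e2
      have hj' : (jk.1 : ℝ) ^ 2 ≤ (K : ℝ) ^ 2 := pow_le_pow_left₀ (by positivity) hj2 2
      have hk' : (jk.2 : ℝ) ^ 2 ≤ (K : ℝ) ^ 2 := pow_le_pow_left₀ (by positivity) hk2 2
      have hπ := Real.pi_pos
      calc mass L (ι jk) ≤ 4 * Real.pi ^ 2 * (jk.1 : ℝ) ^ 2 / (L : ℝ) ^ 2 + 4 * Real.pi ^ 2 * (jk.2 : ℝ) ^ 2 / (L : ℝ) ^ 2 :=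
            add_le_add e1 e2
        _ ≤ 4 * Real.pi ^ 2 * (K : ℝ) ^ 2 / (L : ℝ) ^ 2 + 4 * Real.pi ^ 2 * (K : ℝ) ^ 2 / (L : ℝ) ^ 2 := by
            gcongr
        _ = 8 * Real.pi ^ 2 * ((K : ℝ) ^ 2 / (L : ℝ) ^ 2) := by ring
        _ ≤ 8 * Real.pi ^ 2 * (1 / (4 * m)) := by
            have hKL2 : (K : ℝ) ^ 2 / (L : ℝ) ^ 2 ≤ 1 / (4 * m) := by
              rw [div_le_div_iff₀ (by positivity) (by positivity)]; linarith
            exact mul_le_mul_of_nonneg_left hKL2 (by positivity)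
        _ = 2 * Real.pi ^ 2 / m := by ring
    have hlo : 8 * (K : ℝ) ^ 2 / (L : ℝ) ^ 2 ≤ mass L (ι jk) := by
      have hj1n : jk.1 ≤ K := (mem_Icc.mp (by rw [hJ] at hjk; exact hjk.1)).2
      have hj2n : jk.2 ≤ K := (mem_Icc.mp (by rw [hJ] at hjk; exact hjk.2)).2
      have e1 := sq_le_eps L (ι jk).1 hL (by rw [hvj]; omega)
      have e2 := sq_le_eps L (ι jk).2 hL (by rw [hvk]; omega)
      rw [hvj] at e1; rw [hvk] at e2
      have hj' : ((K : ℝ) / 2) ^ 2 ≤ (jk.1 : ℝ) ^ 2 := pow_le_pow_left₀ (by positivity) hj1 2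
      have hk' : ((K : ℝ) / 2) ^ 2 ≤ (jk.2 : ℝ) ^ 2 := pow_le_pow_left₀ (by positivity) hk1 2
      calc 8 * (K : ℝ) ^ 2 / (L : ℝ) ^ 2 = 16 * ((K : ℝ) / 2) ^ 2 / (L : ℝ) ^ 2 + 16 * ((K : ℝ) / 2) ^ 2 / (L : ℝ) ^ 2 := by
            ring
        _ ≤ 16 * (jk.1 : ℝ) ^ 2 / (L : ℝ) ^ 2 + 16 * (jk.2 : ℝ) ^ 2 / (L : ℝ) ^ 2 := by gcongr
        _ ≤ mass L (ι jk) := by unfold mass; exact add_le_add e1 e2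
    have hm0 := mass_nonneg L (ι jk)
    calc c0 * (K : ℝ) ^ 2 / (2 * (L : ℝ) ^ 2) = (8 * (K : ℝ) ^ 2 / (L : ℝ) ^ 2) / 16 * c0 := by ring
      _ ≤ mass L (ι jk) / 16 * Real.exp (-(m * mass L (ι jk)) / 8) := by
          gcongr
          rw [hc0]
          refine Real.exp_le_exp.mpr ?_
          rw [neg_div, neg_le_neg_iff, div_le_div_iff₀ (by norm_num) (by norm_num)]
          calc ↑m * mass L (ι jk) * 4 ≤ ↑m * (2 * Real.pi ^ 2 / ↑m) * 4 := by gcongr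
            _ = Real.pi ^ 2 * 8 := by field_simp; norm_num
      _ ≤ mass L (ι jk) * 8 ^ m / (mass L (ι jk) + 8) ^ (m + 1) := le_massD_term L m (ι jk)
  -- sum over the box
  have hc0pos : 0 < c0 := Real.exp_pos _
  calc Real.exp (-(Real.pi ^ 2 / 4)) / 2048 * (L : ℝ) ^ 2 / (m : ℝ) ^ 2
      ≤ ((K : ℝ) / 2) * ((K : ℝ) / 2) * (c0 * (K : ℝ) ^ 2 / (2 * (L : ℝ) ^ 2)) := by
        -- `L⁴ ≤ 256 m² K⁴`
        rw [← hc0]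
        have h4 : (L : ℝ) ^ 2 * (L : ℝ) ^ 2 ≤ (16 * m * (K : ℝ) ^ 2) * (16 * m * (K : ℝ) ^ 2) :=
          mul_le_mul hKr'.le hKr'.le (by positivity) (by positivity)
        rw [div_le_iff₀ (by positivity)]
        calc c0 / 2048 * (L : ℝ) ^ 2 = c0 / 2048 * ((L : ℝ) ^ 2 * (L : ℝ) ^ 2) / (L : ℝ) ^ 2 := by field_simp
          _ ≤ c0 / 2048 * ((16 * m * (K : ℝ) ^ 2) * (16 * m * (K : ℝ) ^ 2)) / (L : ℝ) ^ 2 := by gcongr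
          _ = (K : ℝ) / 2 * ((K : ℝ) / 2) * (c0 * (K : ℝ) ^ 2 / (2 * (L : ℝ) ^ 2)) * (m : ℝ) ^ 2 := by
              field_simp; ring
    _ ≤ (J.card : ℝ) * (J.card : ℝ) * (c0 * (K : ℝ) ^ 2 / (2 * (L : ℝ) ^ 2)) := by gcongr
    _ = ∑ jk ∈ (J ×ˢ J : Finset (ℕ × ℕ)), c0 * (K : ℝ) ^ 2 / (2 * (L : ℝ) ^ 2) := by
        rw [sum_const, card_product, nsmul_eq_mul]; push_cast; ring
    _ ≤ ∑ jk ∈ (J ×ˢ J : Finset (ℕ × ℕ)), mass L (ι jk) * 8 ^ m / (mass L (ι jk) + 8) ^ (m + 1) := sum_le_sum hbox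
    _ = ∑ q ∈ (J ×ˢ J : Finset (ℕ × ℕ)).image ι, mass L q * 8 ^ m / (mass L q + 8) ^ (m + 1) :=
        (sum_image (f := fun q => mass L q * 8 ^ m / (mass L q + 8) ^ (m + 1)) hinj).symm
    _ ≤ massD L m := by
        unfold massD
        exact sum_le_sum_of_subset_of_nonneg (subset_univ _) (fun q _ _ => massD_term_nonneg L m q)

end TreeRatio

/-- **Upper bound on the mass weights** (registered sub-goal `TreeRatioMassUpper`): `D(m) ≤ 1700 L²/m²` for `1 ≤ m ≤ L²`, with `D` written out. -/
theorem TreeRatioMassUpper : ∀ (L : ℕ) [NeZero L] (m : ℕ), 1 ≤ m → m ≤ L ^ 2 → ∑ q : ZMod L × ZMod L, ((2 - 2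
    * Real.cos (2 * Real.pi * (q.1.val : ℝ) / L)) + (2 - 2 * Real.cos (2 * Real.pi * (q.2.val : ℝ) / L))) * 8
    ^ m / (((2 - 2 * Real.cos (2 * Real.pi * (q.1.val : ℝ) / L)) + (2 - 2 * Real.cos (2 * Real.pi * (q.2.val
    : ℝ) / L))) + 8) ^ (m + 1) ≤ 1700 * (L : ℝ) ^ 2 / (m : ℝ) ^ 2 :=
  fun L _ _ hm hmL => TreeRatio.massD_le L hm hmL

end Summit.QuantumFields.YangMills.Theorems.FemtoCurvatureSkewness

end
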